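import Mathlib.LinearAlgebra.Matrix.Hermitian
import Mathlib.LinearAlgebra.Matrix.NonsingularInverse
import Mathlib.Data.Complex.Basic
import Mathlib.Data.Real.Star
import Mathlib.Tactic.Linarith

/-!
# The determinant class of a hermitian matrix is a congruence invariant — Shimura Lemma 1.6, the «only if» half,
and the lower bound «at least two classes per dimension» (cell pub-hodge-repro2, seat p3)

Tier-5 N2 support, row N2.2.2 of route/T5-N2-route-3.md (the NON-split case): HKS96 «For a fixed dimension m
there are precisely two isomorphism classes of (non-degenerate) Hermitian spaces over E, and these are
distinguished by the coset (−1)^{m(m−1)/2} det V · N E^× in F^×/N E^×» (deposit ll. 70–74), and N2.7.1: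
Shimura, Arithmetic of hermitian forms (Doc. Math. 13 (2008)), Lemma 1.6 (p. 745, S-6) «Two hermitian spaces
(V, ϕ) and (V′, ϕ′) in the local case are isomorphic if and only if dim(V) = dim(V′) and d₀(ϕ) = d₀(ϕ′)», with
`d₀ := (−1)^{n(n−1)/2} det · N` (§1.2, p. 744, S-3).

This file makes the ELEMENTARY half kernel, over any commutative ring `E` with an involution `star` (so over
every `E_v = F⁺_v(√θ)` of the route, and over `ℂ`, `ℝ`, the split algebra of file 131 alike):
* `det_conjTranspose_mul_mul`: `det (Pᴴ H P) = N(det P) · det H` with `N(u) = star u · u`;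
* `IsCongruent H H' := ∃ P, IsUnit P.det ∧ Pᴴ H P = H'` is an equivalence relation preserving hermitian-ness;
* `IsCongruent.exists_discr_eq`: congruent matrices have `d₀(H') = N(u) · d₀(H)` for a unit `u` — the class of
  `d₀` in `F^×/N(E^×)` is an isometry invariant («only if» of Lemma 1.6; `dim` is an invariant by the type);
* the LOWER BOUND: if some star-fixed `a` is not the norm of a unit, `1` and `diag(a, 1, …, 1)` are invertible
  hermitian and NOT congruent (`not_isCongruent_one_diagOne`, `exists_two_classes`) — «at least two classes in
  each dimension ≥ 1»; instantiated on `ℂ` with `a = −1` (`not_isCongruent_one_diagOne_complex`, the signature)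
  and on a trivially-starred `ℝ` (`not_isCongruent_one_diagOne_real`, Sylvester's simplest case).
What stays print in the route is the UPPER bound «exactly two» (Lemma 1.6's «if»: local universality of binary
hermitian forms + the index `(Ḟ_𝔭 : N Ė_𝔓) = 2`). Mathlib only. No display; no device.
§8(d): uses an L-value-free non-vanishing device: NO.
-/

namespace Summit.Ventures.HodgeRepro2.T5HermitianDetClass

open Matrix

section CommRing

variable {E : Type*} [CommRing E] [StarRing E] {n : Type*} [Fintype n] [DecidableEq n]

/-- `det (Pᴴ H P) = (star (det P) · det P) · det H`: the determinant of a congruent matrix is the old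
determinant times the norm `N(det P)`. -/
theorem det_conjTranspose_mul_mul (P H : Matrix n n E) :
    (Pᴴ * H * P).det = (star P.det * P.det) * H.det := by
  rw [det_mul, det_mul, det_conjTranspose]
  ring

/-- **Congruence** of two square matrices: `H' = Pᴴ H P` for some `P` with invertible determinant — the
isometry of the hermitian (or skew-hermitian) forms with Gram matrices `H`, `H'`. -/
def IsCongruent (H H' : Matrix n n E) : Prop := ∃ P : Matrix n n E, IsUnit P.det ∧ Pᴴ * H * P = H'

/-- `H ≅ H` (`P = 1`). -/
theorem isCongruent_refl (H : Matrix n n E) : IsCongruent H H :=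
  ⟨1, by simp, by simp⟩

/-- `H ≅ H' → H' ≅ H` (`P ↦ P⁻¹`). -/
theorem IsCongruent.symm {H H' : Matrix n n E} (h : IsCongruent H H') : IsCongruent H' H := by
  obtain ⟨P, hP, rfl⟩ := h
  have hPH : IsUnit Pᴴ.det := by rw [det_conjTranspose]; exact isUnit_star.mpr hP
  refine ⟨P⁻¹, isUnit_nonsing_inv_det P hP, ?_⟩
  rw [conjTranspose_nonsing_inv, Matrix.mul_assoc, Matrix.mul_assoc, mul_nonsing_inv P hP,
    Matrix.mul_one, ← Matrix.mul_assoc, nonsing_inv_mul Pᴴ hPH, Matrix.one_mul]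

/-- `H ≅ H' → H' ≅ H'' → H ≅ H''` (`P ↦ P₁ P₂`). -/
theorem IsCongruent.trans {H H' H'' : Matrix n n E} (h₁ : IsCongruent H H') (h₂ : IsCongruent H' H'') :
    IsCongruent H H'' := by
  obtain ⟨P₁, hP₁, rfl⟩ := h₁
  obtain ⟨P₂, hP₂, rfl⟩ := h₂
  refine ⟨P₁ * P₂, by rw [det_mul]; exact hP₁.mul hP₂, ?_⟩
  rw [conjTranspose_mul]
  simp only [Matrix.mul_assoc]

/-- Congruence preserves hermitian-ness. -/
theorem IsCongruent.isHermitian {H H' : Matrix n n E} (h : IsCongruent H H') (hH : H.IsHermitian) :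
    H'.IsHermitian := by
  obtain ⟨P, -, rfl⟩ := h
  exact isHermitian_conjTranspose_mul_mul P hH

/-- `x` is the norm `star u · u` of a unit `u`. -/
def IsUnitNorm (x : E) : Prop := ∃ u : E, IsUnit u ∧ x = star u * u

/-- The determinant of a congruent matrix differs by the norm of a unit. -/
theorem IsCongruent.exists_det_eq {H H' : Matrix n n E} (h : IsCongruent H H') :
    ∃ u : E, IsUnit u ∧ H'.det = (star u * u) * H.det := by
  obtain ⟨P, hP, rfl⟩ := h
  exact ⟨P.det, hP, det_conjTranspose_mul_mul P H⟩

/-- Congruence preserves invertibility of the determinant. -/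
theorem IsCongruent.isUnit_det_iff {H H' : Matrix n n E} (h : IsCongruent H H') :
    IsUnit H.det ↔ IsUnit H'.det := by
  constructor
  · intro hH
    obtain ⟨u, hu, hdet⟩ := h.exists_det_eq
    rw [hdet]
    exact ((isUnit_star.mpr hu).mul hu).mul hH
  · intro hH'
    obtain ⟨u, hu, hdet⟩ := h.symm.exists_det_eq
    rw [hdet]
    exact ((isUnit_star.mpr hu).mul hu).mul hH'

/-- The determinant of a hermitian matrix is star-fixed (lies in the fixed ring `F`). -/
theorem IsHermitian.star_det {H : Matrix n n E} (hH : H.IsHermitian) : star H.det = H.det := by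
  rw [← det_conjTranspose, hH.eq]

/-- **Shimura's `d₀`** (§1.2, p. 744): `d₀(H) = (−1)^{n(n−1)/2} · det H`, read here as an element of `E`
(its class in `F^×/N(E^×)` is the printed invariant). -/
def discr (H : Matrix n n E) : E :=
  (-1) ^ (Fintype.card n * (Fintype.card n - 1) / 2) * H.det

/-- `d₀` of a hermitian matrix is star-fixed. -/
theorem IsHermitian.star_discr {H : Matrix n n E} (hH : H.IsHermitian) : star (discr H) = discr H := by
  unfold discr
  rw [star_mul', star_pow, star_neg, star_one, IsHermitian.star_det hH]

/-- `d₀` is unchanged by congruence up to the norm of a unit: the «only if» half of Shimura Lemma 1.6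
(same dimension by the type, `d₀(H') = N(u) · d₀(H)`). -/
theorem IsCongruent.exists_discr_eq {H H' : Matrix n n E} (h : IsCongruent H H') :
    ∃ u : E, IsUnit u ∧ discr H' = (star u * u) * discr H := by
  obtain ⟨u, hu, hdet⟩ := h.exists_det_eq
  refine ⟨u, hu, ?_⟩
  unfold discr
  rw [hdet]
  ring

/-- If `det H' = a · det H` with `det H` a unit and `H ≅ H'`, then `a` is the norm of a unit. -/
theorem IsCongruent.isUnitNorm_of_det_eq {H H' : Matrix n n E} (h : IsCongruent H H') (hH : IsUnit H.det)
    {a : E} (hdet : H'.det = a * H.det) : IsUnitNorm a := by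
  obtain ⟨u, hu, hu'⟩ := h.exists_det_eq
  refine ⟨u, hu, ?_⟩
  have : a * H.det = (star u * u) * H.det := by rw [← hdet, hu']
  exact hH.mul_right_cancel this

end CommRing

section LowerBound

variable {E : Type*} [CommRing E] [StarRing E] {m : ℕ}

/-- The witness `diag(a, 1, …, 1)` of size `m + 1`. -/
def diagOne (a : E) : Matrix (Fin (m + 1)) (Fin (m + 1)) E :=
  diagonal (fun i => if i = 0 then a else 1)

omit [StarRing E] in
/-- `det diag(a, 1, …, 1) = a`. -/
theorem det_diagOne (a : E) : (diagOne (m := m) a).det = a := by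
  unfold diagOne
  rw [det_diagonal, Finset.prod_ite_eq' Finset.univ (0 : Fin (m + 1)) (fun _ => a)]
  simp

/-- `diag(a, 1, …, 1)` is hermitian when `a` is star-fixed. -/
theorem isHermitian_diagOne {a : E} (ha : star a = a) : (diagOne (m := m) a).IsHermitian := by
  unfold diagOne
  refine isHermitian_diagonal_of_self_adjoint _ ?_
  ext i
  by_cases hi : i = 0 <;> simp [hi, ha]

/-- **The lower bound.** If the star-fixed `a` is not the norm of a unit, `1` and `diag(a, 1, …, 1)` are two
invertible hermitian matrices of the same size that are NOT congruent. -/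
theorem not_isCongruent_one_diagOne {a : E} (ha : ¬ IsUnitNorm a) :
    ¬ IsCongruent (1 : Matrix (Fin (m + 1)) (Fin (m + 1)) E) (diagOne a) := by
  intro h
  apply ha
  exact h.isUnitNorm_of_det_eq (by simp) (by rw [det_diagOne, det_one, mul_one])

/-- «At least two isometry classes of non-degenerate hermitian forms in each dimension `≥ 1`» as soon as
one star-fixed unit is not a norm — the elementary half of row N2.2.2's «precisely two». -/
theorem exists_two_classes (m : ℕ) (h : ∃ a : E, star a = a ∧ IsUnit a ∧ ¬ IsUnitNorm a) :
    ∃ H H' : Matrix (Fin (m + 1)) (Fin (m + 1)) E,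
      H.IsHermitian ∧ H'.IsHermitian ∧ IsUnit H.det ∧ IsUnit H'.det ∧ ¬ IsCongruent H H' := by
  obtain ⟨a, ha, hu, hn⟩ := h
  exact ⟨1, diagOne a, isHermitian_one, isHermitian_diagOne ha, by simp,
    by rw [det_diagOne]; exact hu, not_isCongruent_one_diagOne hn⟩

end LowerBound

section Field

variable {E : Type*} [Field E] [StarRing E]

/-- Over a field, «norm of a unit» = «norm of a non-zero element». -/
theorem isUnitNorm_iff {a : E} : IsUnitNorm a ↔ ∃ u : E, u ≠ 0 ∧ a = star u * u := by
  unfold IsUnitNorm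
  simp only [isUnit_iff_ne_zero]

/-- Over a field: if `a` is not a norm of a non-zero element, `1 ≇ diag(a, 1, …, 1)` in every size `m + 1`. -/
theorem not_isCongruent_one_diagOne_of_field {m : ℕ} {a : E}
    (hn : ¬ ∃ u : E, u ≠ 0 ∧ a = star u * u) :
    ¬ IsCongruent (1 : Matrix (Fin (m + 1)) (Fin (m + 1)) E) (diagOne a) :=
  not_isCongruent_one_diagOne (fun h => hn (isUnitNorm_iff.mp h))

/-- The two-classes statement over a field: a star-fixed non-zero non-norm gives two non-congruent invertible
hermitian matrices in every dimension `≥ 1`. -/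
theorem exists_two_classes_of_field (m : ℕ)
    (h : ∃ a : E, star a = a ∧ a ≠ 0 ∧ ¬ ∃ u : E, u ≠ 0 ∧ a = star u * u) :
    ∃ H H' : Matrix (Fin (m + 1)) (Fin (m + 1)) E,
      H.IsHermitian ∧ H'.IsHermitian ∧ IsUnit H.det ∧ IsUnit H'.det ∧ ¬ IsCongruent H H' := by
  obtain ⟨a, ha, ha0, hn⟩ := h
  exact exists_two_classes m ⟨a, ha, isUnit_iff_ne_zero.mpr ha0, fun h' => hn (isUnitNorm_iff.mp h')⟩

end Field

section Instances

/-- Over `ℂ` with complex conjugation, `−1` is not a norm: `star u · u = ‖u‖² ≥ 0`. -/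
theorem not_isUnitNorm_neg_one_complex : ¬ IsUnitNorm (-1 : ℂ) := by
  rintro ⟨u, -, hu⟩
  have h1 : ((-1 : ℂ)).re = -1 := by simp
  rw [hu, Complex.star_def, ← Complex.normSq_eq_conj_mul_self, Complex.ofReal_re] at h1
  linarith [Complex.normSq_nonneg u]

/-- The two classes of hermitian forms over `ℂ` in every dimension `≥ 1`: `1 ≇ diag(−1, 1, …, 1)`
(the signature distinguishes them; here only the determinant is used). -/
theorem not_isCongruent_one_diagOne_complex (m : ℕ) :
    ¬ IsCongruent (1 : Matrix (Fin (m + 1)) (Fin (m + 1)) ℂ) (diagOne (-1)) :=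
  not_isCongruent_one_diagOne not_isUnitNorm_neg_one_complex

/-- Over `ℝ` (trivial star), `−1` is not a norm: `u · u ≥ 0`. -/
theorem not_isUnitNorm_neg_one_real : ¬ IsUnitNorm (-1 : ℝ) := by
  rintro ⟨u, -, hu⟩
  rw [star_trivial] at hu
  linarith [mul_self_nonneg u]

/-- Sylvester's simplest case, as a determinant-class statement: `1 ≇ diag(−1, 1, …, 1)` over `ℝ`. -/
theorem not_isCongruent_one_diagOne_real (m : ℕ) :
    ¬ IsCongruent (1 : Matrix (Fin (m + 1)) (Fin (m + 1)) ℝ) (diagOne (-1)) :=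
  not_isCongruent_one_diagOne not_isUnitNorm_neg_one_real

end Instances

end Summit.Ventures.HodgeRepro2.T5HermitianDetClass
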